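import Mathlib
import Summits.KontsevichZagierPeriods.Zeta5Search.AperyFrobeniusFactorisation

/-!
# AperyOffDigitBinomials — exact factorisation of the off-digit binomials `C(np, jp+i)`, `C((n+j)p+i, jp+i)`
(cell zeta5-irr)

HONEST FRAMING: systematic search; no irrationality claim unless certified. INSTRUMENT lemma of the ζ(5)
census cell zeta5-irr (HOME `run/shared/lean/pub/zeta5-irr/`; proof file `zi-p2/probes/B8/thm3-j246682/THEOREM3.md`
Step 4 «OFF-DIGIT COEFFICIENT LEMMA» (4a), certificate kit j246682 C-3; typed shape `OffDigitCoefficient3` of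
`zi-p2/SketchT3.lean`). Nothing here is about ζ(5); no irrationality content; filing moves no rung. Filed by the
cell's engine seat zi-eng (g6).

## What the cell uses (THEOREM3.md Step 4a)

For `K = jp + i` with `0 ≤ j < n`, `1 ≤ i ≤ p − 1` (the non-digit indices in `[0, np]`), the pure coefficient
`c_{K,2}(np) = C(np,K)² C(np+K,K)²` of the Apéry `ζ(3)` kernel equals `p²·(n−j)²·c_{j,2}(n)·ε_K` with `ε_K` a `p`-adic
UNIT, `ε_K ≡ i⁻² (mod p)`.  The mechanism is an EXACT factorisation of the two binomials through the block products
`W_m = ∏_{1≤ℓ≤mp, p∤ℓ} ℓ` (`(mp)! = p^m·m!·W_m`, the tree's `FrobeniusFactorisation.factorial_mul_eq`):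

* `C(np, jp+i) · W_j · W_{n−j} · ∏_{t=1}^{i}(jp+t) = p · (n−j) · C(n,j) · W_n · ∏_{t=1}^{i−1}((n−j)p − t)`,
* `C((n+j)p+i, jp+i) · W_j · W_n · ∏_{t=1}^{i}(jp+t) = C(n+j,j) · W_{n+j} · ∏_{t=1}^{i}((n+j)p + t)`,

in which every displayed product other than the binomials and `p·(n−j)·C(n,j)` is prime to `p`.  Hence
`v_p(C(np, jp+i)) = 1 + v_p((n−j)C(n,j))` and `v_p(C((n+j)p+i, jp+i)) = v_p(C(n+j,j))` EXACTLY (not only a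
congruence), which is the valuation half of (4a).

## What is PROVED here (everything; standard axioms)

* `blockW p m = ∏_{1≤ℓ≤mp, p∤ℓ} ℓ` and `factorial_mul_eq_blockW` (`(mp)! = p^m m! W_m`);
* `factorial_add_eq_mul_prod` (`(N+i)! = N!·∏_{t=1}^{i}(N+t)`), `factorial_sub_mul_prod` (`(M−i)!·∏_{t<i}(M−t) = M!`);
* **`choose_offDigit_mul_eq`** and **`choose_shift_offDigit_mul_eq`** — the two exact identities above (any `p ≥ 1`);
* coprimality of the cofactors for a prime `p` (`coprime_blockW`, `coprime_prod_mul_add`, `coprime_prod_mul_sub`) and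
  the EXACT VALUATIONS **`padicValNat_choose_offDigit`**, **`padicValNat_choose_shift_offDigit`**;
* the reductions mod `p` (`cast_blockW`: `W_m ≡ (−1)^m`, Wilson block by block; `cast_prod_mul_add`: `∏(jp+t) ≡ i!`;
  `cast_prod_mul_sub`: `∏_{t<i}((n−j)p−t) ≡ (−1)^{i−1}(i−1)!`) and the UNIT PART of the off-digit binomial
  **`cast_choose_offDigit_div_mul`**: with `C(np,jp+i) = p^{1+v}c`, `(n−j)C(n,j) = p^v y` (`p ∤ c, y`),
  `c·i ≡ (−1)^{i−1} y (mod p)` — squared, this is `ε_K ≡ i⁻²` for the factor `C(np,K)²` of (4a).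

Not covered: the unit part of the shifted binomial (`≡ C(n+j,j)`'s unit part, same three reductions), the residue
correction (4b), and the `ζ(2)` kernel's `(−1)ⁿ n!` normalisation (the binomial identities are the same).
-/

namespace Summit.KontsevichZagierPeriods.Zeta5Search.OffDigitBinomials

open Finset Nat
open Summit.KontsevichZagierPeriods.Zeta5Search.FrobeniusFactorisation (factorial_mul_eq
  prod_filter_not_dvd_eq_prod_prod)

/-! ## Block products and factorial splittings -/

/-- The block product `W_m = ∏_{1≤ℓ≤mp, p∤ℓ} ℓ` (so that `(mp)! = p^m·m!·W_m`). -/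
def blockW (p m : ℕ) : ℕ := ∏ ℓ ∈ (Icc 1 (m * p)).filter (fun ℓ => ¬ p ∣ ℓ), ℓ

/-- `(mp)! = p^m · m! · W_m` (the tree's `FrobeniusFactorisation.factorial_mul_eq`). -/
theorem factorial_mul_eq_blockW {p : ℕ} (hp : 0 < p) (m : ℕ) : (m * p)! = p ^ m * m ! * blockW p m :=
  factorial_mul_eq hp m

/-- `W_m ≠ 0`. -/
theorem blockW_ne_zero (p m : ℕ) : blockW p m ≠ 0 := by
  unfold blockW
  rw [Finset.prod_ne_zero_iff]
  intro ℓ hℓ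
  rw [mem_filter, mem_Icc] at hℓ
  omega

/-- `(N + i)! = N! · ∏_{t=1}^{i}(N + t)`. [folklore] -/
theorem factorial_add_eq_mul_prod (N : ℕ) : ∀ i : ℕ, (N + i)! = N ! * ∏ t ∈ Icc 1 i, (N + t)
  | 0 => by simp
  | i + 1 => by
      rw [Finset.prod_Icc_succ_top (by omega), ← mul_assoc, ← factorial_add_eq_mul_prod N i,
        ← add_assoc, Nat.factorial_succ, mul_comm]

/-- `(M − i)! · ∏_{t<i}(M − t) = M!` for `i ≤ M`. [folklore] -/
theorem factorial_sub_mul_prod (M : ℕ) : ∀ i : ℕ, i ≤ M → (M - i)! * ∏ t ∈ range i, (M - t) = M !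
  | 0, _ => by simp
  | i + 1, h => by
      rw [Finset.prod_range_succ, ← mul_assoc, mul_right_comm,
        show (M - (i + 1))! * (M - i) = (M - i)! by
          rw [show M - i = (M - (i + 1)) + 1 by omega, Nat.factorial_succ, mul_comm]]
      exact factorial_sub_mul_prod M i (by omega)

/-- `∏_{t<i}(M − t) = M · ∏_{t=1}^{i−1}(M − t)` for `1 ≤ i`. [folklore] -/
theorem prod_range_sub_eq (M : ℕ) {i : ℕ} (hi : 1 ≤ i) :
    ∏ t ∈ range i, (M - t) = M * ∏ t ∈ Icc 1 (i - 1), (M - t) := by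
  obtain ⟨k, rfl⟩ : ∃ k, i = k + 1 := ⟨i - 1, by omega⟩
  rw [Finset.range_eq_Ico, Finset.prod_eq_prod_Ico_succ_bot (by omega), Nat.sub_zero, Nat.add_sub_cancel]
  simp only [zero_add, Finset.Ico_add_one_right_eq_Icc]

/-! ## The two exact identities -/

section identities

variable {p : ℕ}

/-- **Off-digit binomial, exact form** (zi-p2 THEOREM3.md Step 4a, mechanism): for `p ≥ 1`, `j < n`, `1 ≤ i < p`,
`C(np, jp+i) · W_j · W_{n−j} · ∏_{t=1}^{i}(jp+t) = p · (n−j) · C(n,j) · W_n · ∏_{t=1}^{i−1}((n−j)p − t)`. -/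
theorem choose_offDigit_mul_eq (hp : 0 < p) {n j i : ℕ} (hjn : j < n) (hi1 : 1 ≤ i) (hip : i < p) :
    (n * p).choose (j * p + i) * (blockW p j * blockW p (n - j) * ∏ t ∈ Icc 1 i, (j * p + t)) =
      p * (n - j) * n.choose j * (blockW p n * ∏ t ∈ Icc 1 (i - 1), ((n - j) * p - t)) := by
  -- notation
  set M := (n - j) * p with hM
  have hMdef : M = n * p - j * p := by rw [hM, Nat.sub_mul]
  have hjp : j * p + p ≤ n * p := by
    have := Nat.mul_le_mul_right p (show j + 1 ≤ n by omega); rwa [add_mul, one_mul] at this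
  have hiM : i ≤ M := by omega
  have hK : j * p + i ≤ n * p := by omega
  have hsub : n * p - (j * p + i) = M - i := by omega
  -- `C · (jp+i)! · (M − i)! = (np)!`
  have h0 := Nat.choose_mul_factorial_mul_factorial hK
  rw [hsub, factorial_add_eq_mul_prod (j * p) i, factorial_mul_eq_blockW hp j,
    factorial_mul_eq_blockW hp n] at h0
  -- multiply by `∏_{t<i}(M − t)` and use `(M − i)!·∏_{t<i}(M−t) = M! = p^{n−j}(n−j)! W_{n−j}`
  have h1 := factorial_sub_mul_prod M i hiM
  rw [hM, factorial_mul_eq_blockW hp (n - j), ← hM] at h1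
  have h2 := prod_range_sub_eq M hi1
  -- `n! = C(n,j) j! (n−j)!` and `p^n = p^j p^{n−j}`
  have h3 := Nat.choose_mul_factorial_mul_factorial hjn.le
  have hpow : p ^ n = p ^ j * p ^ (n - j) := by rw [← pow_add, Nat.add_sub_cancel' hjn.le]
  -- cancel the common factor `p^n · j! · (n−j)!`
  have hne : 0 < p ^ n * j ! * (n - j)! := by positivity
  apply Nat.eq_of_mul_eq_mul_right hne
  calc (n * p).choose (j * p + i) * (blockW p j * blockW p (n - j) * ∏ t ∈ Icc 1 i, (j * p + t)) *
        (p ^ n * j ! * (n - j)!)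
      = (n * p).choose (j * p + i) * (p ^ j * j ! * blockW p j * ∏ t ∈ Icc 1 i, (j * p + t)) *
          (p ^ (n - j) * (n - j)! * blockW p (n - j)) := by rw [hpow]; ring
    _ = (n * p).choose (j * p + i) * (p ^ j * j ! * blockW p j * ∏ t ∈ Icc 1 i, (j * p + t)) *
          ((M - i)! * ∏ t ∈ range i, (M - t)) := by rw [h1]
    _ = ((n * p).choose (j * p + i) * (p ^ j * j ! * blockW p j * ∏ t ∈ Icc 1 i, (j * p + t)) *
          (M - i)!) * ∏ t ∈ range i, (M - t) := by ring
    _ = p ^ n * n ! * blockW p n * ∏ t ∈ range i, (M - t) := by rw [h0]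
    _ = p ^ n * (n.choose j * j ! * (n - j)!) * blockW p n * (M * ∏ t ∈ Icc 1 (i - 1), (M - t)) := by
          rw [h3, h2]
    _ = p * (n - j) * n.choose j * (blockW p n * ∏ t ∈ Icc 1 (i - 1), ((n - j) * p - t)) *
          (p ^ n * j ! * (n - j)!) := by rw [hM]; ring

/-- **Shifted off-digit binomial, exact form** (zi-p2 THEOREM3.md Step 4a, mechanism): for `p ≥ 1`, `1 ≤ i < p` and
all `n, j`: `C((n+j)p+i, jp+i) · W_j · W_n · ∏_{t=1}^{i}(jp+t) = C(n+j,j) · W_{n+j} · ∏_{t=1}^{i}((n+j)p + t)`. -/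
theorem choose_shift_offDigit_mul_eq (hp : 0 < p) (n j i : ℕ) :
    ((n + j) * p + i).choose (j * p + i) * (blockW p j * blockW p n * ∏ t ∈ Icc 1 i, (j * p + t)) =
      (n + j).choose j * (blockW p (n + j) * ∏ t ∈ Icc 1 i, ((n + j) * p + t)) := by
  have hK : j * p + i ≤ (n + j) * p + i := by nlinarith
  have hsub : (n + j) * p + i - (j * p + i) = n * p := by
    rw [add_mul]; omega
  have h0 := Nat.choose_mul_factorial_mul_factorial hK
  rw [hsub, factorial_add_eq_mul_prod (j * p) i, factorial_add_eq_mul_prod ((n + j) * p) i,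
    factorial_mul_eq_blockW hp j, factorial_mul_eq_blockW hp n, factorial_mul_eq_blockW hp (n + j)] at h0
  have h3 := Nat.choose_mul_factorial_mul_factorial (Nat.le_add_left j n)
  rw [Nat.add_sub_cancel] at h3
  have hpow : p ^ (n + j) = p ^ j * p ^ n := by rw [← pow_add, add_comm]
  have hne : 0 < p ^ (n + j) * j ! * n ! := by positivity
  apply Nat.eq_of_mul_eq_mul_right hne
  calc ((n + j) * p + i).choose (j * p + i) * (blockW p j * blockW p n * ∏ t ∈ Icc 1 i, (j * p + t)) *
        (p ^ (n + j) * j ! * n !)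
      = ((n + j) * p + i).choose (j * p + i) * (p ^ j * j ! * blockW p j * ∏ t ∈ Icc 1 i, (j * p + t)) *
          (p ^ n * n ! * blockW p n) := by rw [hpow]; ring
    _ = p ^ (n + j) * (n + j)! * blockW p (n + j) * ∏ t ∈ Icc 1 i, ((n + j) * p + t) := by rw [h0]
    _ = p ^ (n + j) * ((n + j).choose j * j ! * n !) * blockW p (n + j) * ∏ t ∈ Icc 1 i, ((n + j) * p + t) := by
          rw [h3]
    _ = (n + j).choose j * (blockW p (n + j) * ∏ t ∈ Icc 1 i, ((n + j) * p + t)) *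
          (p ^ (n + j) * j ! * n !) := by ring

end identities

/-! ## Coprimality of the cofactors and the exact valuations (prime `p`) -/

section valuations

variable {p : ℕ}

/-- `W_m` is prime to `p`. -/
theorem coprime_blockW (hp : p.Prime) (m : ℕ) : Nat.Coprime p (blockW p m) := by
  unfold blockW
  exact Nat.Coprime.prod_right fun ℓ hℓ ↦ (Nat.Prime.coprime_iff_not_dvd hp).2 (mem_filter.1 hℓ).2

/-- `∏_{t=1}^{i}(jp + t)` is prime to `p` for `i < p`. -/
theorem coprime_prod_mul_add (hp : p.Prime) (j : ℕ) {i : ℕ} (hip : i < p) :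
    Nat.Coprime p (∏ t ∈ Icc 1 i, (j * p + t)) := by
  refine Nat.Coprime.prod_right fun t ht ↦ (Nat.Prime.coprime_iff_not_dvd hp).2 fun hd ↦ ?_
  rw [mem_Icc] at ht
  have ht' : p ∣ t := (Nat.dvd_add_right (dvd_mul_left p j)).1 hd
  have := Nat.le_of_dvd (by omega) ht'
  omega

/-- `∏_{t=1}^{i−1}(mp − t)` is prime to `p` for `i < p` (and `1 ≤ m`). -/
theorem coprime_prod_mul_sub (hp : p.Prime) {m i : ℕ} (hm : 1 ≤ m) (hip : i < p) :
    Nat.Coprime p (∏ t ∈ Icc 1 (i - 1), (m * p - t)) := by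
  refine Nat.Coprime.prod_right fun t ht ↦ (Nat.Prime.coprime_iff_not_dvd hp).2 fun hd ↦ ?_
  rw [mem_Icc] at ht
  have hmp : p ≤ m * p := Nat.le_mul_of_pos_left p hm
  have ht' : p ∣ t := by
    have h := Nat.dvd_sub (dvd_mul_left p m) hd
    rwa [Nat.sub_sub_self (by omega)] at h
  have := Nat.le_of_dvd (by omega) ht'
  omega

/-- **Exact valuation of the off-digit binomial** (zi-p2 THEOREM3.md Step 4a, valuation half): for a prime `p`,
`j < n` and `1 ≤ i < p`, `v_p(C(np, jp+i)) = 1 + v_p((n−j)·C(n,j))`. -/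
theorem padicValNat_choose_offDigit (hp : p.Prime) {n j i : ℕ} (hjn : j < n) (hi1 : 1 ≤ i) (hip : i < p) :
    padicValNat p ((n * p).choose (j * p + i)) = 1 + padicValNat p ((n - j) * n.choose j) := by
  haveI := Fact.mk hp
  have h := congrArg (padicValNat p) (choose_offDigit_mul_eq hp.pos hjn hi1 hip)
  have hC : (n * p).choose (j * p + i) ≠ 0 := by
    refine (Nat.choose_pos ?_).ne'
    have := Nat.mul_le_mul_right p (show j + 1 ≤ n by omega)
    rw [add_mul, one_mul] at this
    omega
  have hC' : n.choose j ≠ 0 := (Nat.choose_pos hjn.le).ne'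
  have hnj : n - j ≠ 0 := by omega
  have hW := blockW_ne_zero p
  have hP1 : ∏ t ∈ Icc 1 i, (j * p + t) ≠ 0 := Finset.prod_ne_zero_iff.2 fun t ht ↦ by
    rw [mem_Icc] at ht; omega
  have hP2 : ∏ t ∈ Icc 1 (i - 1), ((n - j) * p - t) ≠ 0 := Finset.prod_ne_zero_iff.2 fun t ht ↦ by
    rw [mem_Icc] at ht
    have : p ≤ (n - j) * p := Nat.le_mul_of_pos_left p (by omega)
    omega
  -- valuations of the cofactors vanish
  have v0 : ∀ {x : ℕ}, Nat.Coprime p x → padicValNat p x = 0 := fun hx ↦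
    padicValNat.eq_zero_of_not_dvd ((Nat.Prime.coprime_iff_not_dvd hp).1 hx)
  have hX : blockW p j * blockW p (n - j) ≠ 0 := mul_ne_zero (hW j) (hW (n - j))
  have hpnj : p * (n - j) ≠ 0 := mul_ne_zero hp.ne_zero hnj
  rw [padicValNat.mul hC (mul_ne_zero hX hP1), padicValNat.mul hX hP1,
    padicValNat.mul (hW j) (hW (n - j)), v0 (coprime_blockW hp j), v0 (coprime_blockW hp (n - j)),
    v0 (coprime_prod_mul_add hp j hip), padicValNat.mul (mul_ne_zero hpnj hC') (mul_ne_zero (hW n) hP2),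
    padicValNat.mul hpnj hC', padicValNat.mul hp.ne_zero hnj, padicValNat.mul (hW n) hP2,
    v0 (coprime_blockW hp n), v0 (coprime_prod_mul_sub hp (show 1 ≤ n - j by omega) hip),
    padicValNat_self] at h
  rw [padicValNat.mul hnj hC']
  omega

/-- **Exact valuation of the shifted off-digit binomial** (zi-p2 THEOREM3.md Step 4a, valuation half): for a prime
`p`, `1 ≤ i < p` and all `n, j`: `v_p(C((n+j)p+i, jp+i)) = v_p(C(n+j,j))`. -/
theorem padicValNat_choose_shift_offDigit (hp : p.Prime) (n j : ℕ) {i : ℕ} (hip : i < p) :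
    padicValNat p (((n + j) * p + i).choose (j * p + i)) = padicValNat p ((n + j).choose j) := by
  haveI := Fact.mk hp
  have h := congrArg (padicValNat p) (choose_shift_offDigit_mul_eq hp.pos n j i)
  have hC : ((n + j) * p + i).choose (j * p + i) ≠ 0 :=
    (Nat.choose_pos (by nlinarith)).ne'
  have hC' : (n + j).choose j ≠ 0 := (Nat.choose_pos (Nat.le_add_left j n)).ne'
  have hW := blockW_ne_zero p
  have hP1 : ∏ t ∈ Icc 1 i, (j * p + t) ≠ 0 := Finset.prod_ne_zero_iff.2 fun t ht ↦ by
    rw [mem_Icc] at ht; omega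
  have hP3 : ∏ t ∈ Icc 1 i, ((n + j) * p + t) ≠ 0 := Finset.prod_ne_zero_iff.2 fun t ht ↦ by
    rw [mem_Icc] at ht; omega
  have v0 : ∀ {x : ℕ}, Nat.Coprime p x → padicValNat p x = 0 := fun hx ↦
    padicValNat.eq_zero_of_not_dvd ((Nat.Prime.coprime_iff_not_dvd hp).1 hx)
  have hX : blockW p j * blockW p n ≠ 0 := mul_ne_zero (hW j) (hW n)
  rw [padicValNat.mul hC (mul_ne_zero hX hP1), padicValNat.mul hX hP1,
    padicValNat.mul (hW j) (hW n), v0 (coprime_blockW hp j), v0 (coprime_blockW hp n),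
    v0 (coprime_prod_mul_add hp j hip), padicValNat.mul hC' (mul_ne_zero (hW (n + j)) hP3),
    padicValNat.mul (hW (n + j)) hP3, v0 (coprime_blockW hp (n + j)), v0 (coprime_prod_mul_add hp (n + j) hip)] at h
  omega

end valuations

/-! ## The unit parts modulo `p` -/

section units

variable {p : ℕ}

/-- `W_m ≡ (−1)^m (mod p)` (Wilson, block by block; any prime `p`). -/
theorem cast_blockW (hp : p.Prime) (m : ℕ) : ((blockW p m : ℕ) : ZMod p) = (-1) ^ m := by
  haveI := Fact.mk hp
  unfold blockW
  rw [prod_filter_not_dvd_eq_prod_prod hp.pos m (fun ℓ => ℓ), Nat.cast_prod]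
  have hblock : ∀ b ∈ range m, (((∏ r ∈ Icc 1 (p - 1), (b * p + r) : ℕ)) : ZMod p) = -1 := by
    intro b _
    rw [Nat.cast_prod]
    have h : ∀ r ∈ Icc 1 (p - 1), (((b * p + r : ℕ)) : ZMod p) = ((r : ℕ) : ZMod p) := by
      intro r _
      push_cast
      rw [ZMod.natCast_self, mul_zero, zero_add]
    rw [Finset.prod_congr rfl h, ← Nat.cast_prod, ← Finset.Ico_add_one_right_eq_Icc,
      Finset.prod_Ico_id_eq_factorial, ZMod.wilsons_lemma]
  rw [Finset.prod_congr rfl hblock, Finset.prod_const, Finset.card_range]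

/-- `∏_{t=1}^{i}(jp + t) ≡ i! (mod p)`. -/
theorem cast_prod_mul_add (p j i : ℕ) :
    ((∏ t ∈ Icc 1 i, (j * p + t) : ℕ) : ZMod p) = ((i ! : ℕ) : ZMod p) := by
  rw [Nat.cast_prod]
  have h : ∀ t ∈ Icc 1 i, (((j * p + t : ℕ)) : ZMod p) = ((t : ℕ) : ZMod p) := by
    intro t _
    push_cast
    rw [ZMod.natCast_self, mul_zero, zero_add]
  rw [Finset.prod_congr rfl h, ← Nat.cast_prod, ← Finset.Ico_add_one_right_eq_Icc,
    Finset.prod_Ico_id_eq_factorial]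

/-- `∏_{t=1}^{i−1}(mp − t) ≡ (−1)^{i−1}(i−1)! (mod p)` for `i ≤ p` and `1 ≤ m`. -/
theorem cast_prod_mul_sub {m i : ℕ} (hm : 1 ≤ m) (hip : i ≤ p) :
    ((∏ t ∈ Icc 1 (i - 1), (m * p - t) : ℕ) : ZMod p) = (-1) ^ (i - 1) * (((i - 1)! : ℕ) : ZMod p) := by
  rw [Nat.cast_prod]
  have hmp : p ≤ m * p := Nat.le_mul_of_pos_left p hm
  have h : ∀ t ∈ Icc 1 (i - 1), (((m * p - t : ℕ)) : ZMod p) = -1 * ((t : ℕ) : ZMod p) := by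
    intro t ht
    rw [mem_Icc] at ht
    rw [Nat.cast_sub (by omega)]
    push_cast
    rw [ZMod.natCast_self, mul_zero, zero_sub, neg_one_mul]
  rw [Finset.prod_congr rfl h, Finset.prod_mul_distrib, Finset.prod_const, Nat.card_Icc,
    Nat.add_sub_cancel, ← Nat.cast_prod, ← Finset.Ico_add_one_right_eq_Icc, Finset.prod_Ico_id_eq_factorial]

/-- **Unit part of the off-digit binomial** (zi-p2 THEOREM3.md Step 4a, unit half): for a prime `p`, `j < n`,
`1 ≤ i < p`, writing `C(np, jp+i) = p^{1+v}·c` and `(n−j)C(n,j) = p^v·y` with `p ∤ c`, `p ∤ y`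
(`v = v_p((n−j)C(n,j))`, `padicValNat_choose_offDigit`): `c·i ≡ (−1)^{i−1}·y (mod p)`. -/
theorem cast_choose_offDigit_div_mul (hp : p.Prime) {n j i : ℕ} (hjn : j < n) (hi1 : 1 ≤ i) (hip : i < p) :
    ((((n * p).choose (j * p + i) / p ^ padicValNat p ((n * p).choose (j * p + i)) : ℕ)) : ZMod p) *
        ((i : ℕ) : ZMod p) =
      (-1) ^ (i - 1) *
        (((((n - j) * n.choose j) / p ^ padicValNat p ((n - j) * n.choose j) : ℕ)) : ZMod p) := by
  haveI := Fact.mk hp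
  set C := (n * p).choose (j * p + i) with hC
  set Y := (n - j) * n.choose j with hY
  set v := padicValNat p Y with hv
  have hvC : padicValNat p C = 1 + v := padicValNat_choose_offDigit hp hjn hi1 hip
  -- exact divisions `C = p^{1+v} c`, `Y = p^v y`
  obtain ⟨c, hc⟩ : p ^ (1 + v) ∣ C := by rw [← hvC]; exact pow_padicValNat_dvd
  obtain ⟨y, hy⟩ : p ^ v ∣ Y := pow_padicValNat_dvd
  have hpv : 0 < p ^ v := pow_pos hp.pos v
  have hcdiv : C / p ^ padicValNat p C = c := by
    rw [hvC, hc, Nat.mul_div_cancel_left _ (pow_pos hp.pos _)]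
  have hydiv : Y / p ^ padicValNat p Y = y := by
    rw [← hv, hy, Nat.mul_div_cancel_left _ hpv]
  rw [hcdiv, hydiv]
  -- the exact identity, divided by `p^{1+v}`: `c·X = y·Y'`
  have key := choose_offDigit_mul_eq hp.pos hjn hi1 hip
  rw [← hC, hc, mul_assoc p (n - j), ← hY, hy] at key
  have key' : c * (blockW p j * blockW p (n - j) * ∏ t ∈ Icc 1 i, (j * p + t)) =
      y * (blockW p n * ∏ t ∈ Icc 1 (i - 1), ((n - j) * p - t)) := by
    apply Nat.eq_of_mul_eq_mul_left (pow_pos hp.pos (1 + v))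
    calc p ^ (1 + v) * (c * (blockW p j * blockW p (n - j) * ∏ t ∈ Icc 1 i, (j * p + t)))
        = p ^ (1 + v) * c * (blockW p j * blockW p (n - j) * ∏ t ∈ Icc 1 i, (j * p + t)) := by ring
      _ = p * (p ^ v * y) * (blockW p n * ∏ t ∈ Icc 1 (i - 1), ((n - j) * p - t)) := key
      _ = p ^ (1 + v) * (y * (blockW p n * ∏ t ∈ Icc 1 (i - 1), ((n - j) * p - t))) := by ring
  -- reduce modulo `p`
  have hz := congrArg (Nat.cast (R := ZMod p)) key'
  simp only [Nat.cast_mul] at hz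
  rw [cast_blockW hp j, cast_blockW hp (n - j), cast_blockW hp n, cast_prod_mul_add p j i,
    cast_prod_mul_sub (show 1 ≤ n - j by omega) hip.le] at hz
  -- `i! = i·(i−1)!`, `(−1)^j (−1)^{n−j} = (−1)^n`
  have hfac : ((i ! : ℕ) : ZMod p) = ((i : ℕ) : ZMod p) * (((i - 1)! : ℕ) : ZMod p) := by
    rw [show i ! = ((i - 1) + 1)! by rw [Nat.sub_add_cancel hi1], Nat.factorial_succ, Nat.sub_add_cancel hi1]
    push_cast
    ring
  have hsign : ((-1 : ZMod p)) ^ j * (-1) ^ (n - j) = (-1) ^ n := by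
    rw [← pow_add, Nat.add_sub_cancel' hjn.le]
  rw [hfac] at hz
  -- cancel the unit `(−1)^n · (i−1)!`
  have hunit : ((-1 : ZMod p)) ^ n * (((i - 1)! : ℕ) : ZMod p) ≠ 0 := by
    refine mul_ne_zero (pow_ne_zero _ (neg_ne_zero.2 one_ne_zero)) ?_
    rw [Ne, ZMod.natCast_eq_zero_iff, hp.dvd_factorial]
    omega
  apply mul_left_cancel₀ hunit
  linear_combination hz - ((((i - 1)! : ℕ) : ZMod p) * (c : ZMod p) * ((i : ℕ) : ZMod p)) * hsign

end units


end Summit.KontsevichZagierPeriods.Zeta5Search.OffDigitBinomials
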